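import Mathlib
import Summits.MatrixMultiplication.Statement
import Summits.MatrixMultiplication.MatrixMultiplication.Theorems.GraphEquationsDerivations

/-!
# The polar lemma: deflation directions exist (M15b; cell `decomp-mm`, lens-5 g28)

Helper kernel beneath crux `MultiplicityReduction` (stmt-MatrixMultiplication-27806), line
`purisplit`, rung `K = 2` of BOP′ — the algebraic heart of one round of kernel-field DEFLATION
(Leykin–Verschelde–Zhao 2006, Thm. 3.1, transplanted; see `GraphEquationsDeflation` for the
dictionary).  Sorry-free content:

* `exists_deflation_direction` — forms `P_o` (`o < T`) of degrees `d_o ≤ 2` on `ℂ^σ` whose common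
  fibre through `0` is `{0}` admit a direction `γ` in the common kernel `N` of the LINEAR members such
  that the LINEAR system `{P_o : d_o = 1} ∪ {D_γ P_o : d_o = 2}` has only the trivial zero.  Proof:
  restrict the quadrics to `N` (pull back along a basis, `pderiv_bind₁_linear`, `eval_bind₁_linear`),
  where they alone isolate the origin; the full-Jacobian-rank theorem
  `exists_jacobian_rank_eq_card_of_isHomogeneous` (M11) gives `γ ∈ N` with injective Jacobian; its
  rows pair with `x ∈ N` to the polars `D_x P_o(γ) = D_γ P_o(x)` (`eval_polarDeriv_comm`).
  ONE direction — generic in `N` — suffices (no frame of `dim N ~ n²` fields).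
* `pderiv_bind₁_linear` (chain rule for a linear substitution), `eval_bind₁_linear`,
  `mulVec_eq_zero_imp` (full column rank ⇒ trivial kernel).

No sorry.
-/

set_option linter.dupNamespace false

noncomputable section

open scoped BigOperators

namespace Summit.MatrixMultiplication.MatrixMultiplication.Theorems.GraphEquations

open MvPolynomial
open Literature.Computability.AlgebraicComplexity

variable {n : ℕ}

/-! ## Deflation directions exist: the polar forms of an isolated net of quadrics -/

/-- Chain rule for a LINEAR substitution `X_q ↦ Σ_k v_k(q) Y_k`. -/
theorem pderiv_bind₁_linear {σ : Type*} [Fintype σ] [DecidableEq σ] {s : ℕ} (v : Fin s → σ → ℂ)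
    (k : Fin s) (P : MvPolynomial σ ℂ) :
    pderiv k (bind₁ (fun q : σ => ∑ j : Fin s, C (v j q) * X j) P) =
      ∑ q, C (v k q) * bind₁ (fun q : σ => ∑ j : Fin s, C (v j q) * X j) (pderiv q P) := by
  have hlf : ∀ q, pderiv k (∑ j : Fin s, C (v j q) * X j : MvPolynomial (Fin s) ℂ) = C (v k q) := fun q => by
    rw [map_sum]
    simp [pderiv_X, Pi.single_apply, Finset.sum_ite_eq']
  have hδ : ∀ q₀ q : σ, bind₁ (fun q : σ => ∑ j : Fin s, C (v j q) * X j) (pderiv q (X q₀ : MvPolynomial σ ℂ)) =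
      if q = q₀ then 1 else 0 := fun q₀ q => by
    by_cases h : q = q₀
    · subst h; simp
    · rw [pderiv_X_of_ne (Ne.symm h), map_zero, if_neg h]
  induction P using MvPolynomial.induction_on with
  | C a => simp
  | add p r hp hr => simp only [map_add, hp, hr, mul_add, Finset.sum_add_distrib]
  | mul_X p q₀ hp =>
    rw [map_mul, bind₁_X_right, pderiv_mul, hp, hlf]
    simp_rw [pderiv_mul, map_add, map_mul, bind₁_X_right, hδ, mul_add, Finset.sum_add_distrib, mul_ite,
      mul_one, mul_zero, Finset.sum_ite_eq', Finset.mem_univ, if_true, Finset.sum_mul]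
    congr 1
    · exact Finset.sum_congr rfl fun q _ => by ring
    · ring


/-- Evaluating the LINEAR pull-back: `(P ∘ ι)(φ) = P(ι φ)` with `ι φ = Σ_k φ_k v_k`. -/
theorem eval_bind₁_linear {σ : Type*} [Fintype σ] {s : ℕ} (v : Fin s → σ → ℂ) (φ : Fin s → ℂ)
    (P : MvPolynomial σ ℂ) :
    eval φ (bind₁ (fun q : σ => ∑ j : Fin s, C (v j q) * X j) P) = eval (fun q => ∑ j, φ j * v j q) P := by
  rw [show eval φ (bind₁ (fun q : σ => ∑ j : Fin s, C (v j q) * X j) P) =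
      eval (fun q => eval φ (∑ j : Fin s, C (v j q) * X j)) P from eval₂Hom_bind₁ _ _ _ _]
  have h : (fun q => eval φ (∑ j : Fin s, C (v j q) * X j)) = fun q => ∑ j, φ j * v j q := by
    funext q
    simp [map_sum, mul_comm]
  rw [h]

/-- A matrix of full column rank has trivial kernel. -/
theorem mulVec_eq_zero_imp {T s : ℕ} (M : Matrix (Fin T) (Fin s) ℂ) (hM : M.rank = s)
    {φ : Fin s → ℂ} (hφ : M.mulVec φ = 0) : φ = 0 := by
  have hli : LinearIndependent ℂ M.col := by
    rw [linearIndependent_iff_card_eq_finrank_span, Set.finrank, ← Matrix.rank_eq_finrank_span_cols, hM,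
      Fintype.card_fin]
  exact Matrix.mulVec_injective_iff.mpr hli (by rw [hφ, Matrix.mulVec_zero])

/-- **DEFLATION DIRECTIONS EXIST (the polar lemma).**  Let `P_o` (`o < T`) be forms of degrees
`d_o ≤ 2` on `ℂ^σ` whose common fibre through the origin is `{0}`.  Then there is a point `γ` of the
common kernel `N` of the LINEAR members such that the linear members together with the polars
`D_γ P_o` of the QUADRATIC members have only the trivial common zero.  (Restrict the quadrics to
`N`, where they alone isolate the origin; by `exists_jacobian_rank_eq_card_of_isHomogeneous` (M11)
their Jacobian has full rank at some `γ ∈ N`; the Jacobian rows at `γ` are the polars `D_γ P_o|_N`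
by the symmetry of second derivatives.)  One direction `γ` — generic in `N` — suffices. -/
theorem exists_deflation_direction {σ : Type} [Fintype σ] [DecidableEq σ] {T : ℕ}
    (P : Fin T → MvPolynomial σ ℂ) (d : Fin T → ℕ) (hP : ∀ o, (P o).IsHomogeneous (d o))
    (hd : ∀ o, d o ≤ 2)
    (hiso : ∀ x : σ → ℂ, (∀ o, eval x (P o) = eval 0 (P o)) → x = 0) :
    ∃ γ : σ → ℂ, (∀ o, d o = 1 → eval γ (P o) = 0) ∧
      ∀ x : σ → ℂ, (∀ o, d o = 1 → eval x (P o) = 0) →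
        (∀ o, d o = 2 → eval x (polarDeriv γ (P o)) = 0) → x = 0 := by
  classical
  -- the common kernel `N` of the linear members
  have hlin : ∀ o, d o = 1 → ∀ x : σ → ℂ, eval x (P o) = ∑ q, coeff (Finsupp.single q 1) (P o) * x q :=
    fun o ho x => eval_eq_sum_of_isHomogeneous_one (by rw [← ho]; exact hP o) x
  let N : Submodule ℂ (σ → ℂ) :=
    { carrier := {x | ∀ o, d o = 1 → eval x (P o) = 0}
      add_mem' := fun {a b} ha hb o ho => by
        have ha' := ha o ho; have hb' := hb o ho
        rw [hlin o ho] at ha' hb' ⊢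
        simp only [Pi.add_apply, mul_add, Finset.sum_add_distrib, ha', hb', add_zero]
      zero_mem' := fun o ho => by rw [hlin o ho]; simp
      smul_mem' := fun c a ha o ho => by
        have ha' := ha o ho
        rw [hlin o ho] at ha' ⊢
        simp only [Pi.smul_apply, smul_eq_mul, mul_left_comm _ c, ← Finset.mul_sum, ha', mul_zero] }
  have hNmem : ∀ x : σ → ℂ, x ∈ N ↔ ∀ o, d o = 1 → eval x (P o) = 0 := fun x => Iff.rfl
  -- a basis of `N` and the linear parametrisation `ι : ℂ^s ≅ N ⊆ ℂ^σ`
  let s := Module.finrank ℂ N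
  let b : Module.Basis (Fin s) ℂ N := Module.finBasis ℂ N
  let v : Fin s → σ → ℂ := fun k => (b k : σ → ℂ)
  let ι : (Fin s → ℂ) → (σ → ℂ) := fun φ q => ∑ j, φ j * v j q
  have hιeq : ∀ φ, ι φ = ((b.equivFun.symm φ : N) : σ → ℂ) := fun φ => by
    funext q
    rw [Module.Basis.equivFun_symm_apply, Submodule.coe_sum, Finset.sum_apply]
    exact Finset.sum_congr rfl fun j _ => by simp [v]
  have hιN : ∀ φ, ι φ ∈ N := fun φ => by rw [hιeq]; exact Subtype.mem _
  have hιinj : ∀ φ, ι φ = 0 → φ = 0 := fun φ hφ => by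
    have h1 : (b.equivFun.symm φ : N) = 0 := by
      apply Subtype.ext; rw [← hιeq]; exact hφ
    have h2 := congrArg b.equivFun h1
    rwa [LinearEquiv.apply_symm_apply, map_zero] at h2
  have hιsurj : ∀ x ∈ N, ∃ φ, ι φ = x := fun x hx =>
    ⟨b.equivFun ⟨x, hx⟩, by rw [hιeq, LinearEquiv.symm_apply_apply]⟩
  -- the pulled-back forms on `ℂ^s`
  let lf : σ → MvPolynomial (Fin s) ℂ := fun q => ∑ j : Fin s, C (v j q) * X j
  have hlf : ∀ q, (lf q).IsHomogeneous 1 := fun q =>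
    IsHomogeneous.sum _ _ _ fun j _ => isHomogeneous_C_mul_X _ _
  let Q : Fin T → MvPolynomial (Fin s) ℂ := fun o => bind₁ lf (P o)
  have hQ : ∀ o, (Q o).IsHomogeneous (d o) := fun o => by
    have h := (hP o).aeval lf hlf
    rwa [one_mul] at h
  have hQeval : ∀ o φ, eval φ (Q o) = eval (ι φ) (P o) := fun o φ => eval_bind₁_linear v φ (P o)
  have hι0 : ι 0 = 0 := by funext q; simp [ι]
  have hisoQ : ∀ φ : Fin s → ℂ, (∀ o, eval φ (Q o) = eval 0 (Q o)) → φ = 0 := fun φ hφ =>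
    hιinj φ (hiso (ι φ) fun o => by rw [← hQeval, hφ o, hQeval, hι0])
  -- full Jacobian rank of the pulled-back family at some `γ' ∈ ℂ^s` (M11)
  obtain ⟨γ', hγ'⟩ := exists_jacobian_rank_eq_card_of_isHomogeneous Q d hQ hisoQ
  rw [Fintype.card_fin] at hγ'
  refine ⟨ι γ', fun o ho => (hNmem _).mp (hιN γ') o ho, fun x hxN hxpol => ?_⟩
  obtain ⟨φ, rfl⟩ := hιsurj x hxN
  -- the Jacobian rows at `γ'` pair with `φ` to the polars
  have hrow : ∀ o, ∑ k, eval γ' (pderiv k (Q o)) * φ k = eval (ι γ') (polarDeriv (ι φ) (P o)) := fun o => by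
    simp only [Q, lf, ι, pderiv_bind₁_linear v, map_sum, map_mul, eval_C, eval_bind₁_linear v, polarDeriv]
    -- Σ_k (Σ_q v k q * e_q) * φ k = Σ_q (Σ_j φ j * v j q) * e_q
    simp only [Finset.sum_mul]
    rw [Finset.sum_comm]
    exact Finset.sum_congr rfl fun q _ => Finset.sum_congr rfl fun k _ => by ring
  have hMφ : (Matrix.of fun o j => eval γ' (pderiv j (Q o)) : Matrix (Fin T) (Fin s) ℂ).mulVec φ = 0 := by
    funext o
    rw [Matrix.mulVec, dotProduct]
    simp only [Matrix.of_apply, Pi.zero_apply]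
    rw [hrow o]
    rcases Nat.lt_or_ge (d o) 1 with h0 | h1
    · -- degree 0: a constant, polar 0
      have hc := eq_C_of_isHomogeneous_zero (show (P o).IsHomogeneous 0 by
        have := hP o; rwa [show d o = 0 by omega] at this)
      rw [hc, polarDeriv_C, map_zero]
    rcases Nat.lt_or_ge (d o) 2 with h1' | h2
    · -- degree 1: `(D_x ℓ)(γ) = ℓ(x) = 0`
      have ho : d o = 1 := by omega
      rw [eval_polarDeriv_of_isHomogeneous_one (by rw [← ho]; exact hP o)]
      exact hxN o ho
    · -- degree 2: symmetry, then the hypothesis on the polars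
      have ho : d o = 2 := le_antisymm (hd o) h2
      rw [← eval_polarDeriv_comm (by rw [← ho]; exact hP o)]
      exact hxpol o ho
  have hφ : φ = 0 := mulVec_eq_zero_imp _ hγ' hMφ
  rw [hφ, hι0]

end Summit.MatrixMultiplication.MatrixMultiplication.Theorems.GraphEquations

end
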